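import Mathlib
import HarnessLib
import Summits.ValiantsHypothesis.ValiantsHypothesis.Theses.MonotoneRestoration
import Literature.Computability.AlgebraicComplexity.ArithCircuit
import Literature.Computability.AlgebraicComplexity.ArithCircuitProofs
import Literature.Computability.AlgebraicComplexity.MonotoneStructure
import Literature.Computability.AlgebraicComplexity.PermanentIrreducible
import Literature.ModelTheory.FiniteModelTheory.CkEquiv
import Summits.ValiantsHypothesis.ValiantsHypothesis.Theorems.MonotoneRestorationMonotoneRestorationQPCosetCount
import Summits.ValiantsHypothesis.ValiantsHypothesis.Theorems.MonotoneRestorationMonotoneRestorationQPSymmetricLB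
import Summits.ValiantsHypothesis.ValiantsHypothesis.Theorems.MonotoneRestorationMonotoneRestorationQPSupportSymmetrisation
import Summits.ValiantsHypothesis.ValiantsHypothesis.Theorems.MonotoneRestorationMonotoneRestorationQPSparseRegime
import Summits.ValiantsHypothesis.ValiantsHypothesis.Theorems.MonotoneRestorationMonotoneRestorationQPBeta
import Literature.Computability.AlgebraicComplexity.SymmetricArithCircuit
import Literature.Computability.AlgebraicComplexity.DawarWilsenach2025Proofs
import Literature.GroupTheory.PermutationGroups.SmallIndexSubgroups
import Summits.ValiantsHypothesis.ValiantsHypothesis.Theorems.MonotoneRestorationQP.Negative.LoadBearing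
import Summits.ValiantsHypothesis.ValiantsHypothesis.Theorems.MonotoneRestorationMonotoneRestorationQPPermSupportCount
import Literature.Computability.AlgebraicComplexity.ArithCircuitVarsCount

/-! TTRL-lite variant V19271 of stmt-ValiantsHypothesis-15886

Target `stub_esymmRowSums_comp` (slug `valian15886-stub-esymmrowsums-comp`), move `lemma_proposal`
(`[vars_le]`, the variable-counting LOWER-bound tool): a fan-in-two circuit of size `s` has at most
`2s` operand slots in its gates plus one output operand, so the polynomial it computes mentions at
most `2s + 1` variables; with the tree's minimal fan-in-two size `complexity`,
`#vars(f) ≤ 2·complexity f + 1`. This is exactly the tree's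
`Literature.Computability.AlgebraicComplexity.card_vars_le_complexity`
(`Literature/Computability/AlgebraicComplexity/ArithCircuitVarsCount.lean`, any commutative
semiring, `[DecidableEq σ]` supplied classically), specialised to coefficients `ℝ≥0`.
-/

-- `Summit.ValiantsHypothesis.ValiantsHypothesis.…` is the tree's mandated single-conjunct layout
-- (Sub = Summit), so the duplicated namespace component is intended.
set_option linter.dupNamespace false

namespace Summit.ValiantsHypothesis.ValiantsHypothesis.Theorems

open Summit.ValiantsHypothesis.ValiantsHypothesis.Theses.MonotoneRestoration
open Literature.Computability.AlgebraicComplexity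

/-- **TTRL-lite variant V19271 of `stub_esymmRowSums_comp`** (variable-counting floor over `ℝ≥0`).
For every polynomial `f` over `ℝ≥0` in variables `σ`, the number of variables occurring in `f` is
at most `2·L(f) + 1`, where `L = complexity` is the minimal size of a fan-in-two arithmetic circuit
computing `f`: each of the `L` gates reads at most two operands and the output is one more operand,
so at most `2L + 1` variables are ever read. Immediate from `card_vars_le_complexity`.
[cite: Burgisser2000, Def. 2.1] -/
theorem stub_esymmRowSums_comp_var19271 :
    ∀ (σ : Type) (f : MvPolynomial σ NNReal), f.vars.card ≤ 2 * complexity f + 1 := by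
  intro σ f
  classical
  exact card_vars_le_complexity f

end Summit.ValiantsHypothesis.ValiantsHypothesis.Theorems
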